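import Literature.NumberTheory.Automorphic.EssConjSelfDual
import Literature.NumberTheory.Automorphic.AsaiSign
import Literature.NumberTheory.Automorphic.ReciprocityGLn
import Literature.NumberTheory.Automorphic.AlgebraicityTwist
import HarnessLib

/-!
# Galois representations for weakly regular, odd, conjugate self-dual cuspidal representations
# of `GL_n` over a CM field (Fakhruddin–Pilloni, Thm. 9.7 and Thm. 9.10)

Topic `NumberTheory/Automorphic`; namespace `Literature.NumberTheory.Automorphic`. Grounding of
route `Langlands/DegenerateLimits` (target `OddPolarizableSatakeA`, crux `CongruencesToRegular`):
the thesis of that route is literally "Theorem 9.10 of Fakhruddin–Pilloni *without* the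
weak-regularity hypothesis", so the printed theorem — the nearest known result — is vendored here
as a named fact, together with Theorem 9.7 (oddness is automatic unless every archimedean weight
multiplicity pairs up), which is what makes the route's hypothesis "some archimedean exponent has
ODD multiplicity" imply oddness in the weakly regular case.

## Source, verbatim (N. Fakhruddin, V. Pilloni, *Hecke operators and the coherent cohomology of
Shimura varieties*, J. Inst. Math. Jussieu 22 (2023) 1–69 = arXiv:1910.03790, §9; bib key
`FakhruddinPilloni2021`)

§9.1 (p. 41 of the arXiv version). `L` CM or totally real, `F ⊆ L` maximal totally real, `c` the
complex conjugation, `J = Hom(L, ℂ)`; `π` a cuspidal automorphic representation of `GL_n / L`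
("we do not assume that the central character of `π` is unitary").
* *Essentially conjugate self dual* (`L` CM): `π^c = π^∨ ⊗ χ`, `χ = χ₀ ∘ N_{L/F} ∘ det`, `χ₀` a
  Hecke character of `F` with `χ₀(-1_v)` independent of `v ∣ ∞`.
* *`C`-algebraic*: the infinitesimal character `λ = ((λ_{1,τ}, …, λ_{n,τ}))_{τ ∈ J}` of `π_∞`
  lies in `((ℤⁿ + (n-1)/2 ℤⁿ)/𝔖_n)^J`.
* *Weakly regular*: "for each `τ ∈ J`, after applying a permutation in `𝔖_n` to the indices, we
  have `λ_{1,τ} > ⋯ > λ_{[n/2],τ}` and `λ_{[n/2]+1,τ} > ⋯ > λ_{n,τ}`"; *regular*: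
  `λ_{1,τ} > ⋯ > λ_{n,τ}`.
* *Odd* (`L` CM): "`L(s, Asai^{(-1)^{n-1} ε(χ₀)}(π) ⊗ χ₀⁻¹)` has a pole at `s = 1`", where
  `ε(χ₀) = χ₀(-1_v)(-1)^q` for `χ₀ = χ₀^f |·|^q`, and `Asai^ε(c)(v ⊗ w) = ε w ⊗ v`.

**Theorem 9.7** (p. 43). "Let `π` be a weakly regular, algebraic, conjugate self dual, cuspidal
automorphic representation of `GL_n / L` [`L` CM, §9.1.2]. Let `λ = (λ_{i,τ})` be its
infinitesimal character. Then `π` is automatically odd unless possibly when `n` is even and for all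
`τ`, `λ_{i,τ} = λ_{i+n/2,τ}` for some ordering of the infinitesimal character." (Proof, p. 44: if
`π` is not odd then `L(s, Asai^{(-1)^n}(π))` has a pole, so `π` descends to `U(n)` through the
*twisted* `L`-group embedding `ξ₋` (Mok); at `v ∣ ∞` this needs a non-degenerate symplectic `A`
with `ᵗρ_v(z̄) A ρ_v(z) = A` for `ρ_v(z) = diag((z/z̄)^{λ_{i,v}})`, which exists only if `n` is
even and the `λ_{i,v}` pair up. The printed proof uses C-algebraicity, cuspidality, conjugate
self-duality and Mok's Thms. 2.4.2, 2.4.10, 2.5.4 (a) with (2.2.6) — not weak regularity; the fact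
below is nevertheless the printed statement, weak regularity included.)

**Theorem 9.10** (p. 44). "Let `π` be a weakly regular, algebraic, odd, (essentially) conjugate
self dual, cuspidal automorphic representation of `GL_n / L`. In particular, `π^c = π^∨ ⊗ χ`.
There is a continuous Galois representation `ρ_{π,ι} : G_L → GL_n(ℚ̄_p)` such that:
(1) `ρ_{π,ι}^c ≃ ρ^∨ ⊗ ε_p^{1-n} ⊗ χ_ι`; (2) `ρ_{π,ι}` is unramified at all finite places `v ∤ p`
for which `π_v` is unramified and one has `WD(ρ_{π,ι}|_{G_{F_v}})^{F-ss} = rec(π_v ⊗ |det|_v^{(1-n)/2})`."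
(Remark 9.9: `rec` sends geometric Frobenius to a uniformizer; `ι : ℂ ≃ ℚ̄_p`. Proof: Sorensen
patching reduces to `L` CM; Mok descent to the quasi-split `U(n)` (Thm. 9.6), `π̃_∞` a
non-degenerate limit of discrete series, realised in coherent cohomology; then Pilloni–Stroh /
Goldring–Koskivirta: "the Hecke eigensystem of `π̃` is a `p`-adic limit of Hecke eigensystems of
regular, essentially conjugate self dual, automorphic representations to which Theorem 9.8
[HLTT/Shin/Chenevier–Harris …] applies".)

## Rendering (what is typed below, and how it differs from print)

* `L := K` a **CM field** (Mathlib `NumberField.IsCMField K`; the totally real case of the print is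
  not vendored), `F = K⁺ = NumberField.maximalRealSubfield K`, `c = NumberField.IsCMField.complexConj K`.
* `π : CuspidalAutomorphicRepData n K hcpt` (Borel–Jacquet datum on genuine cusp forms, accepted
  `AutomorphicRepsGL`); its infinitesimal character at `τ` is `(T τ).map ArchWeight.a` for an
  infinity type `T` of `π` (accepted `AutomorphicRepData.HasInfinityType`, which only reads these
  multisets). *C-algebraic* = accepted `InfinityType.IsCAlgebraic`. *Weakly regular* =
  `InfinityType.IsWeaklyRegular` (**new definition**, literal: at every `τ` the multiset of the
  `λ_{i,τ}` splits as `μ + ν` with `card μ = [n/2]`, `μ` and `ν` without repetition — a strictly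
  decreasing enumeration of a finite set of the reals `(n-1)/2 + ℤ` being the same as an
  enumeration without repetition). The exceptional configuration of Thm. 9.7 ("`n` even and, for
  all `τ`, `λ_{i,τ} = λ_{i+n/2,τ}` for some ordering") = `InfinityType.IsEvenlyPaired` (**new
  definition**: `Even n ∧ ∀ τ, ∃ μ, λ_τ = μ + μ`).
* *Conjugate self dual* (`χ = 1`, the case of Thm. 9.7, and the case of Thm. 9.10 vendored here) =
  accepted `AutomorphicRepData.IsEssConjSelfDual π 1` (`EssConjSelfDual`, pairing form of
  `π^c ≅ π^∨`). The essentially-conjugate-self-dual case of Thm. 9.10 (`χ = χ₀ ∘ N ∘ det` with the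
  sign condition) is NOT vendored: its oddness condition needs the `χ₀⁻¹`-twisted Asai
  `L`-function, absent from the tree (F–P, §9.1.2: "if `π` is essentially conjugate self dual, there
  exists an algebraic Hecke character `ψ` such that `π ⊗ ψ` is conjugate self dual").
* *Odd* for `χ = χ₀ = 1` (`ε(χ₀) = 1`): `L(s, Asai^{(-1)^{n-1}}(π))` has a pole at `s = 1` =
  accepted `AutomorphicRepData.HasAsaiSign π c 1` of `AsaiSign` (Mok's sign `κ = +1`:
  `L^S(s, π, As^{(-1)^{n+1}})` has a (simple) pole at `s = 1` for every Asai datum; for a conjugate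
  self-dual cuspidal `π` — unitary, since `ω_π ∘ c = ω_π⁻¹` — the partial and complete Asai
  `L`-functions differ at `s = 1` by finitely many holomorphic non-vanishing local factors, and the
  pole is simple by Mok, §2.5; F–P's `Asai^ε(c)(v ⊗ w) = ε w ⊗ v` is Mok's `As^ε`).
* Conclusion of Thm. 9.10: clause (1) (the polarisation `ρ^c ≃ ρ^∨ ε^{1-n} χ_ι`) is **omitted**
  (so the fact is weaker than print there); clause (2) is rendered at the unramified places
  exactly as the identical formula of Harris–Lan–Taylor–Thorne, Thm. A is rendered in the accepted
  `exists_galoisRep_of_regularAlgebraic` (lang.S27, `ReciprocityGLn`): at every finite `v ∤ ℓ`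
  where `π` has Satake parameter `α` (unitary normalisation), `r` is unramified and the
  characteristic polynomial of the *arithmetic* Frobenius is
  `arithFrobPolyOfSatake ι q_v n α = ∏_j (X - ι⁻¹((q_v^{(n-1)/2} α_j)⁻¹))` (geometric Frobenius
  eigenvalues `ι⁻¹(q_v^{(n-1)/2} α_j)` = `ι⁻¹ rec(π_v ⊗ |det|^{(1-n)/2})(Frob_v)`; our
  `ι : ℚ̄_ℓ ≃+* ℂ` is the inverse of F–P's). Continuity is part of `FramedGaloisRep`.
* Relation to the route (`Summits/Langlands/Langlands/Theses/DegenerateLimits.lean`): its items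
  are stated for **L-algebraic** `π` with `arithFrobPolyOfSatake ι q_v 1 α`; pass through the
  accepted twist API (`CuspidalAutomorphicRepData.exists_twist_hasInfinityType`,
  `InfinityType.isCAlgebraic_iff_isLAlgebraic_twist`, `HasSatakeParamAt.of_map_mulChar_detTwist_of_cpow`)
  exactly as in the evidence file `RegularSatakeA_of_HLTT.lean` of item `RegularSatakeA`. The
  route's target `OddPolarizableSatakeA` is STRONGER than Thm. 9.7 + Thm. 9.10: it drops weak
  regularity (multiplicities `≥ 3` allowed) and asks for a semisimple `ρ`.

## Contents

* `InfinityType.IsWeaklyRegular`, `InfinityType.IsEvenlyPaired` (definitions) with the sanity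
  lemmas `IsRegular.isWeaklyRegular` (regular ⇒ weakly regular, for types with `n` weights) and
  `not_isEvenlyPaired_of_odd_count` (an exponent of odd multiplicity at one embedding excludes
  the exceptional configuration — the route's hypothesis (i)).
* Named facts (D-0014, not proved here): `FakhruddinPilloni2021_odd_of_weaklyRegular` (Thm. 9.7)
  and `FakhruddinPilloni2021_galoisRep_of_weaklyRegular_odd` (Thm. 9.10, CM, `χ = 1`), and the
  proved composite `FakhruddinPilloni2021_galoisRep_of_odd_count` (9.7 + 9.10 under an
  odd-multiplicity exponent).

Searched (2026-08-15): `lean search 'FakhruddinPilloni|WeaklyRegular'` — only `EssConjSelfDual`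
(§9.1 notion) and Mathlib's unrelated `RingTheory.Sequence.IsWeaklyRegular`; no Galois
representations for irregular `π` anywhere in the tree (`NonRegularWeightBarrier` records the gap).
-/

noncomputable section

open scoped NumberField
open NumberField IsDedekindDomain

namespace Literature.NumberTheory.Automorphic

/-! ### Weak regularity and the evenly-paired configuration (F–P §9.1, Thm. 9.7) -/

namespace InfinityType

variable {K : Type*} [Field K] {n : ℕ}

/-- **Weakly regular** infinity type (Fakhruddin–Pilloni, §9.1): at every complex embedding `τ`,
"after applying a permutation in `𝔖_n` to the indices, we have `λ_{1,τ} > ⋯ > λ_{[n/2],τ}` and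
`λ_{[n/2]+1,τ} > ⋯ > λ_{n,τ}`" for the infinitesimal character `λ_τ = (T τ).map ArchWeight.a`;
literally: `λ_τ = μ + ν` with `card μ = [n/2]` and `μ`, `ν` free of repetitions (for the real
numbers `λ_{i,τ} ∈ (n-1)/2 + ℤ` of a C-algebraic type, "strictly decreasing after reordering" is
"without repetition"). Equivalently every `λ_{i,τ}` has multiplicity `≤ 2`.
[cite: FakhruddinPilloni2021, §9.1 (Weakly regular)] -/
def IsWeaklyRegular (T : InfinityType K n) : Prop :=
  ∀ σ : K →+* ℂ, ∃ μ ν : Multiset ℂ, (T σ).map ArchWeight.a = μ + ν ∧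
    Multiset.card μ = n / 2 ∧ μ.Nodup ∧ ν.Nodup

/-- The **exceptional configuration of Fakhruddin–Pilloni, Thm. 9.1 / Thm. 9.7**: "`n` is even and
for all `τ`, `λ_{i,τ} = λ_{i+n/2,τ}` for all `1 ≤ i ≤ n/2`, for some ordering of the infinitesimal
character", i.e. at every embedding the multiset of exponents is a double `μ + μ` (every
multiplicity even). [cite: FakhruddinPilloni2021, Thm. 9.7] -/
def IsEvenlyPaired (T : InfinityType K n) : Prop :=
  Even n ∧ ∀ σ : K →+* ℂ, ∃ μ : Multiset ℂ, (T σ).map ArchWeight.a = μ + μ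

/-- Regular ⇒ weakly regular, for an infinity type with `n` weights at each embedding (the first
clause of `IsWellFormed`): split any enumeration after `[n/2]` terms.
[cite: FakhruddinPilloni2021, §9.1 (Weakly regular)] -/
theorem IsRegular.isWeaklyRegular {T : InfinityType K n} (hT : T.IsRegular)
    (hcard : ∀ σ : K →+* ℂ, Multiset.card (T σ) = n) : T.IsWeaklyRegular := by
  intro σ
  obtain ⟨l, hl⟩ := Quotient.exists_rep ((T σ).map ArchWeight.a)
  have hl' : ((l : Multiset ℂ)) = (T σ).map ArchWeight.a := hl
  have hnd : l.Nodup := by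
    have h := hT σ
    rw [← hl'] at h
    exact Multiset.coe_nodup.mp h
  have hlen : l.length = n := by
    have h := hcard σ
    rw [← Multiset.card_map ArchWeight.a, ← hl'] at h
    exact h
  refine ⟨(l.take (n / 2) : Multiset ℂ), (l.drop (n / 2) : Multiset ℂ), ?_, ?_, ?_, ?_⟩
  · rw [← hl', Multiset.coe_add, List.take_append_drop]
  · rw [Multiset.coe_card, List.length_take, hlen]
    exact Nat.min_eq_left (Nat.div_le_self n 2)
  · exact Multiset.coe_nodup.mpr (hnd.sublist (List.take_sublist _ _))
  · exact Multiset.coe_nodup.mpr (hnd.sublist (List.drop_sublist _ _))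

/-- An exponent of **odd multiplicity** at one embedding rules out the evenly-paired
configuration (multiplicities in `μ + μ` are even) — hypothesis (i) of route
`Langlands/DegenerateLimits`. [cite: FakhruddinPilloni2021, Thm. 9.7] -/
theorem not_isEvenlyPaired_of_odd_count {T : InfinityType K n} {σ : K →+* ℂ} {a : ℂ}
    (h : Odd (((T σ).map ArchWeight.a).count a)) : ¬ T.IsEvenlyPaired := by
  classical
  rintro ⟨-, hp⟩
  obtain ⟨μ, hμ⟩ := hp σ
  rw [hμ, Multiset.count_add] at h
  exact (Nat.not_even_iff_odd.mpr h) ⟨_, rfl⟩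

end InfinityType

/-! ### The named facts -/

/-- **Fakhruddin–Pilloni, Theorem 9.7** (oddness is automatic). Printed: "Let `π` be a weakly
regular, algebraic, conjugate self dual, cuspidal automorphic representation of `GL_n / L` [`L` a
CM field]. Let `λ = (λ_{i,τ})` be its infinitesimal character. Then `π` is automatically odd unless
possibly when `n` is even and for all `τ`, `λ_{i,τ} = λ_{i+n/2,τ}` for some ordering of the
infinitesimal character." Rendering (module docstring): `K` CM, `π` cuspidal (Borel–Jacquet datum)
with an infinity type `T` that is C-algebraic and weakly regular, `π^c ≅ π^∨`
(`IsEssConjSelfDual π 1`); conclusion: `π` is odd — `L(s, Asai^{(-1)^{n-1}}(π))` has a pole at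
`s = 1`, i.e. Mok's sign `+1`, `HasAsaiSign π c 1` — or `T` is evenly paired. Named fact (D-0014),
not proved here; grounds the passage "(i) ⇒ oddness" of
`Summit.Langlands.Langlands.Theses.DegenerateLimits.OddPolarizableSatakeA` in the weakly regular
case. [cite: FakhruddinPilloni2021, Thm. 9.7] [cite: Mok2014, Thm. 2.5.4 (a)] -/
def FakhruddinPilloni2021_odd_of_weaklyRegular : Prop :=
  ∀ (n : ℕ) (K : Type) [Field K] [NumberField K] [IsCMField K]
    (hcpt : isCompact_glFiniteIntegralLevel n K) (π : CuspidalAutomorphicRepData n K hcpt)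
    (T : InfinityType K n), π.1.HasInfinityType T → T.IsCAlgebraic → T.IsWeaklyRegular →
      π.1.IsEssConjSelfDual 1 →
        π.1.HasAsaiSign (NumberField.IsCMField.complexConj K) 1 ∨ T.IsEvenlyPaired

/-- **Fakhruddin–Pilloni, Theorem 9.10** (Galois representations in the weakly regular odd case;
CM field, `χ = 1`). Printed: "Let `π` be a weakly regular, algebraic, odd, (essentially) conjugate
self dual, cuspidal automorphic representation of `GL_n / L`. In particular, `π^c = π^∨ ⊗ χ`. There
is a continuous Galois representation `ρ_{π,ι} : G_L → GL_n(ℚ̄_p)` such that: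
`ρ_{π,ι}^c ≃ ρ^∨ ⊗ ε_p^{1-n} ⊗ χ_ι` …; `ρ_{π,ι}` is unramified at all finite places `v ∤ p` for
which `π_v` is unramified and one has `WD(ρ_{π,ι}|_{G_{F_v}})^{F-ss} = rec(π_v ⊗ |det|_v^{(1-n)/2})`."
Rendering (module docstring): `K` CM, `χ = 1` (`IsEssConjSelfDual π 1`), oddness as
`HasAsaiSign π c 1`, infinity type C-algebraic and weakly regular; conclusion WITHOUT the
polarisation clause: for every `ℓ` and `ι : ℚ̄_ℓ ≃+* ℂ` a continuous `r : Γ_K → GL_n(ℚ̄_ℓ)`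
(`FramedGaloisRep`) which, at every finite `v ∤ ℓ` where `π` has Satake parameter `α`, is
unramified with arithmetic-Frobenius characteristic polynomial `arithFrobPolyOfSatake ι q_v n α`
— the rendering of the same formula in the accepted lang.S27
`exists_galoisRep_of_regularAlgebraic`. Named fact (D-0014), not proved here; grounds the weakly
regular sub-case of `Summit.Langlands.Langlands.Theses.DegenerateLimits.OddPolarizableSatakeA`
(which is STRONGER: no weak regularity, semisimple `ρ`). [cite: FakhruddinPilloni2021, Thm. 9.10] -/
def FakhruddinPilloni2021_galoisRep_of_weaklyRegular_odd : Prop :=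
  ∀ (n : ℕ) (K : Type) [Field K] [NumberField K] [IsCMField K]
    (hcpt : isCompact_glFiniteIntegralLevel n K) (π : CuspidalAutomorphicRepData n K hcpt)
    (T : InfinityType K n), π.1.HasInfinityType T → T.IsCAlgebraic → T.IsWeaklyRegular →
      π.1.IsEssConjSelfDual 1 → π.1.HasAsaiSign (NumberField.IsCMField.complexConj K) 1 →
        ∀ (ℓ : ℕ) [Fact ℓ.Prime] (ι : PadicAlgCl ℓ ≃+* ℂ),
          ∃ r : GaloisRepresentations.FramedGaloisRep K (PadicAlgCl ℓ) n,
            ∀ (v : HeightOneSpectrum (𝓞 K)) (α : Multiset ℂ), π.1.HasSatakeParamAt v α →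
              ((ℓ : ℕ) : 𝓞 K) ∉ v.asIdeal →
                r.IsUnramifiedAt v ∧
                  r.HasFrobCharpolyAt v (arithFrobPolyOfSatake ι v.residueCard n α)

/-- **Thm. 9.7 + Thm. 9.10 combined, under an odd-multiplicity exponent** (proved from the two
named facts): for `K` CM and `π` cuspidal, conjugate self-dual, with a C-algebraic weakly regular
infinity type having at some embedding an exponent of odd multiplicity, the Galois representations
of Thm. 9.10 exist — the weakly regular sub-case of the target of route
`Langlands/DegenerateLimits` (in C-normalisation). [cite: FakhruddinPilloni2021, Thm. 9.7 and Thm. 9.10] -/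
theorem FakhruddinPilloni2021_galoisRep_of_odd_count
    (h97 : FakhruddinPilloni2021_odd_of_weaklyRegular)
    (h910 : FakhruddinPilloni2021_galoisRep_of_weaklyRegular_odd)
    {n : ℕ} {K : Type} [Field K] [NumberField K] [IsCMField K]
    {hcpt : isCompact_glFiniteIntegralLevel n K} (π : CuspidalAutomorphicRepData n K hcpt)
    {T : InfinityType K n} (hT : π.1.HasInfinityType T) (hC : T.IsCAlgebraic)
    (hW : T.IsWeaklyRegular) {σ : K →+* ℂ} {a : ℂ}
    (hodd : Odd (((T σ).map ArchWeight.a).count a)) (hsd : π.1.IsEssConjSelfDual 1)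
    (ℓ : ℕ) [Fact ℓ.Prime] (ι : PadicAlgCl ℓ ≃+* ℂ) :
    ∃ r : GaloisRepresentations.FramedGaloisRep K (PadicAlgCl ℓ) n,
      ∀ (v : HeightOneSpectrum (𝓞 K)) (α : Multiset ℂ), π.1.HasSatakeParamAt v α →
        ((ℓ : ℕ) : 𝓞 K) ∉ v.asIdeal →
          r.IsUnramifiedAt v ∧ r.HasFrobCharpolyAt v (arithFrobPolyOfSatake ι v.residueCard n α) := by
  have hodd' : π.1.HasAsaiSign (NumberField.IsCMField.complexConj K) 1 := by
    rcases h97 n K hcpt π T hT hC hW hsd with h | h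
    · exact h
    · exact absurd h (InfinityType.not_isEvenlyPaired_of_odd_count hodd)
  exact h910 n K hcpt π T hT hC hW hsd hodd' ℓ ι

/-! ### Appended 2026-08-15 (grounder g22-10): the essentially conjugate self-dual case `χ = ‖·‖^m`

Route `Langlands/DegenerateLimits` assumes conjugate self-duality only **up to `|det|^m`**
(hypothesis (ii) of `OddPolarizableSatakeA`: `β = α.map (a ↦ a⁻¹ q_v^{-m})`, produced from
`π^c ≅ π^∨ ⊗ ‖det‖^m` by the accepted `IsEssConjSelfDual.eventually_satakeParam_complexConj_eq`).
The facts above treat `χ = 1`; the following records Thm. 9.10 for `χ = ‖·‖_𝔸^m`, `m ∈ ℤ`, with the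
oddness hypothesis discharged by **Thm. 9.1** (the essentially (conjugate) self-dual version of
Thm. 9.7, printed p. 41 of arXiv:1910.03790: "Let `π` be a weakly regular, algebraic, essentially
(conjugate) self dual, cuspidal automorphic representation of `GL_n/L`. Then `π` is odd unless
possibly when `n` is even and for all `τ ∈ J`, there is an ordering of the infinitesimal character
… such that `λ_{i,τ} = λ_{i+n/2,τ}` for all `1 ≤ i ≤ n/2`" = `IsEvenlyPaired`). Faithfulness:
F–P's `χ = χ₀ ∘ N_{L/L⁺} ∘ det` with `χ₀,v(-1)` independent of `v ∣ ∞`; for `χ = ‖·‖_{𝔸_L}^m =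
‖·‖_{𝔸_{L⁺}}^m ∘ N_{L/L⁺}` one has `χ₀,v(-1) = 1` at every `v ∣ ∞`, so the factorisation and
the sign condition demanded by the docstring of `IsEssConjSelfDual` hold — a SPECIALISATION of the
printed hypotheses; the conclusion is Thm. 9.10's second bullet in the lang.S27 rendering, the
polarisation bullet `ρ^c ≅ ρ^∨ ⊗ ε^{1-n} ⊗ χ_ι` again omitted (and said to be omitted).
-/

open Literature.NumberTheory.GaloisRepresentations (HeckeCharacter ideleGroup ideleNorm) in
/-- **Fakhruddin–Pilloni, Thm. 9.10 with Thm. 9.1 (CM field, `χ = ‖·‖_𝔸^m`).** Let `K` be a CM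
field and `π` a cuspidal automorphic representation of `GL_n(𝔸_K)` with an infinity type `T` that
is C-algebraic, weakly regular and NOT evenly paired (so `π` is odd by Thm. 9.1), and suppose
`π^c ≅ π^∨ ⊗ (χ ∘ det)` (`IsEssConjSelfDual π χ`) for the Hecke character `χ = ‖·‖_𝔸^m`, `m ∈ ℤ`.
Then for every prime `ℓ` and `ι : ℚ̄_ℓ ≃+* ℂ` there is a continuous `r : Γ_K → GL_n(ℚ̄_ℓ)` which
at every finite `v ∤ ℓ` where `π` has Satake parameter `α` is unramified with arithmetic-Frobenius
characteristic polynomial `arithFrobPolyOfSatake ι q_v n α` (printed: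
`WD(ρ_{π,ι}|_{G_{L_v}})^{F-ss} = rec(π_v ⊗ |det|_v^{(1-n)/2})`, Rem. 9.9). Polarisation clause
omitted. Named fact (D-0014), not proved here; with `m = 0` it is
`FakhruddinPilloni2021_galoisRep_of_weaklyRegular_odd ∘ FakhruddinPilloni2021_odd_of_weaklyRegular`.
Grounds the weakly regular sub-case of
`Summit.Langlands.Langlands.Theses.DegenerateLimits.OddPolarizableSatakeA` for general `m`.
[cite: FakhruddinPilloni2021, Thm. 9.10 and Thm. 9.1] -/
def FakhruddinPilloni2021_galoisRep_of_weaklyRegular_normTwist : Prop :=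
  ∀ (n : ℕ) (K : Type) [Field K] [NumberField K] [IsCMField K]
    (hcpt : isCompact_glFiniteIntegralLevel n K) (π : CuspidalAutomorphicRepData n K hcpt)
    (T : InfinityType K n), π.1.HasInfinityType T → T.IsCAlgebraic → T.IsWeaklyRegular →
      ¬ T.IsEvenlyPaired →
        ∀ (χ : HeckeCharacter K) (m : ℤ),
          (∀ x : ideleGroup K, ((χ x : ℂˣ) : ℂ) = (ideleNorm x : ℂ) ^ (m : ℂ)) →
            π.1.IsEssConjSelfDual χ →
              ∀ (ℓ : ℕ) [Fact ℓ.Prime] (ι : PadicAlgCl ℓ ≃+* ℂ),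
                ∃ r : GaloisRepresentations.FramedGaloisRep K (PadicAlgCl ℓ) n,
                  ∀ (v : HeightOneSpectrum (𝓞 K)) (α : Multiset ℂ), π.1.HasSatakeParamAt v α →
                    ((ℓ : ℕ) : 𝓞 K) ∉ v.asIdeal →
                      r.IsUnramifiedAt v ∧
                        r.HasFrobCharpolyAt v (arithFrobPolyOfSatake ι v.residueCard n α)

/-- The `normTwist` fact under an exponent of odd multiplicity (route hypothesis (i)): the
evenly-paired exception is excluded by `not_isEvenlyPaired_of_odd_count` (proved composite).
[cite: FakhruddinPilloni2021, Thm. 9.10 and Thm. 9.1] -/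
theorem FakhruddinPilloni2021_galoisRep_of_odd_count_normTwist
    (h : FakhruddinPilloni2021_galoisRep_of_weaklyRegular_normTwist)
    {n : ℕ} {K : Type} [Field K] [NumberField K] [IsCMField K]
    {hcpt : isCompact_glFiniteIntegralLevel n K} (π : CuspidalAutomorphicRepData n K hcpt)
    {T : InfinityType K n} (hT : π.1.HasInfinityType T) (hC : T.IsCAlgebraic)
    (hW : T.IsWeaklyRegular) {σ : K →+* ℂ} {a : ℂ}
    (hodd : Odd (((T σ).map ArchWeight.a).count a))
    {χ : Literature.NumberTheory.GaloisRepresentations.HeckeCharacter K} {m : ℤ}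
    (hχ : ∀ x : Literature.NumberTheory.GaloisRepresentations.ideleGroup K,
      ((χ x : ℂˣ) : ℂ) = (Literature.NumberTheory.GaloisRepresentations.ideleNorm x : ℂ) ^ (m : ℂ))
    (hsd : π.1.IsEssConjSelfDual χ) (ℓ : ℕ) [Fact ℓ.Prime] (ι : PadicAlgCl ℓ ≃+* ℂ) :
    ∃ r : GaloisRepresentations.FramedGaloisRep K (PadicAlgCl ℓ) n,
      ∀ (v : HeightOneSpectrum (𝓞 K)) (α : Multiset ℂ), π.1.HasSatakeParamAt v α →
        ((ℓ : ℕ) : 𝓞 K) ∉ v.asIdeal →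
          r.IsUnramifiedAt v ∧ r.HasFrobCharpolyAt v (arithFrobPolyOfSatake ι v.residueCard n α) :=
  h n K hcpt π T hT hC hW (InfinityType.not_isEvenlyPaired_of_odd_count hodd) χ m hχ hsd ℓ ι


/-! ### Appended 2026-08-15 (literature-prover, provefact seat for the `normTwist` fact): the slice
`m = 0` of `FakhruddinPilloni2021_galoisRep_of_weaklyRegular_normTwist` is Thm. 9.7 + Thm. 9.10
(`χ = 1`)

The `normTwist` fact is Thm. 9.10 of Fakhruddin–Pilloni for `χ = ‖·‖_𝔸^m` (with Thm. 9.1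
supplying oddness outside the evenly-paired configuration). Its printed proof (p. 44 of
arXiv:1910.03790: Sorensen patching; Mok's endoscopic descent to the quasi-split `U(n)`,
Thm. 9.6; realisation of the non-degenerate limit of discrete series `π̃_∞` in the coherent
cohomology of a unitary Shimura variety; `p`-adic interpolation of its Hecke eigensystem by
regular eigensystems (Pilloni–Stroh, Goldring–Koskivirta); Thm. 9.8 for those) has no counterpart
in Mathlib or in `Literature/`, so the fact is not discharged here. What IS elementary is recorded
as proved theorems: for `m = 0` the hypothesis `χ = ‖·‖^0` forces `χ = 1`
(`HeckeCharacter.ext`), Thm. 9.7 (`FakhruddinPilloni2021_odd_of_weaklyRegular`) turns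
"not evenly paired" into oddness, and Thm. 9.10 for `χ = 1`
(`FakhruddinPilloni2021_galoisRep_of_weaklyRegular_odd`) gives the representation. (For even
`m = 2k` one reduces to `m = 0` by the twist `π ⊗ ‖det‖^{-k}` and a Tate twist of the Galois
representation by `ε_ℓ^{k}`; for odd `m` the printed route twists by an algebraic Hecke
character `ψ` of the CM field with `ψ ψ^c = ‖·‖^{-m}`, F–P §9.1.2 — neither reduction is
carried out in this file.)
-/

open Literature.NumberTheory.GaloisRepresentations (HeckeCharacter ideleGroup ideleNorm) in
/-- A Hecke character equal to `‖·‖_𝔸^0` is the trivial character. [folklore] -/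
theorem HeckeCharacter.eq_one_of_eq_ideleNorm_cpow_zero {K : Type*} [Field K] [NumberField K]
    {χ : HeckeCharacter K}
    (hχ : ∀ x : ideleGroup K, ((χ x : ℂˣ) : ℂ) = (ideleNorm x : ℂ) ^ ((0 : ℤ) : ℂ)) :
    χ = 1 := by
  refine HeckeCharacter.ext fun x => Units.ext ?_
  rw [hχ x, Int.cast_zero, Complex.cpow_zero, HeckeCharacter.one_apply, Units.val_one]

open Literature.NumberTheory.GaloisRepresentations (HeckeCharacter ideleGroup ideleNorm) in
/-- **The slice `m = 0` of `FakhruddinPilloni2021_galoisRep_of_weaklyRegular_normTwist` follows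
from Thm. 9.7 and Thm. 9.10 (`χ = 1`)**: if `χ = ‖·‖_𝔸^0` then `χ = 1`, so `π` is conjugate
self-dual; not evenly paired ⇒ odd (Thm. 9.7, `FakhruddinPilloni2021_odd_of_weaklyRegular`);
Thm. 9.10 for `χ = 1` (`FakhruddinPilloni2021_galoisRep_of_weaklyRegular_odd`) gives `r`.
Proved composite (the two named facts enter as hypotheses; no new fact).
[cite: FakhruddinPilloni2021, Thm. 9.7 and Thm. 9.10] -/
theorem FakhruddinPilloni2021_galoisRep_of_weaklyRegular_normTwist_zero
    (h97 : FakhruddinPilloni2021_odd_of_weaklyRegular)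
    (h910 : FakhruddinPilloni2021_galoisRep_of_weaklyRegular_odd)
    {n : ℕ} {K : Type} [Field K] [NumberField K] [IsCMField K]
    {hcpt : isCompact_glFiniteIntegralLevel n K} (π : CuspidalAutomorphicRepData n K hcpt)
    {T : InfinityType K n} (hT : π.1.HasInfinityType T) (hC : T.IsCAlgebraic)
    (hW : T.IsWeaklyRegular) (hE : ¬ T.IsEvenlyPaired) {χ : HeckeCharacter K}
    (hχ : ∀ x : ideleGroup K, ((χ x : ℂˣ) : ℂ) = (ideleNorm x : ℂ) ^ ((0 : ℤ) : ℂ))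
    (hsd : π.1.IsEssConjSelfDual χ) (ℓ : ℕ) [Fact ℓ.Prime] (ι : PadicAlgCl ℓ ≃+* ℂ) :
    ∃ r : GaloisRepresentations.FramedGaloisRep K (PadicAlgCl ℓ) n,
      ∀ (v : HeightOneSpectrum (𝓞 K)) (α : Multiset ℂ), π.1.HasSatakeParamAt v α →
        ((ℓ : ℕ) : 𝓞 K) ∉ v.asIdeal →
          r.IsUnramifiedAt v ∧ r.HasFrobCharpolyAt v (arithFrobPolyOfSatake ι v.residueCard n α) := by
  have hχ1 : χ = 1 := HeckeCharacter.eq_one_of_eq_ideleNorm_cpow_zero hχ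
  subst hχ1
  rcases h97 n K hcpt π T hT hC hW hsd with hodd | hpaired
  · exact h910 n K hcpt π T hT hC hW hsd hodd ℓ ι
  · exact absurd hpaired hE

/-- The `normTwist` fact restricted to `m = 0` is a consequence of the two `χ = 1` facts: the
statement of `FakhruddinPilloni2021_galoisRep_of_weaklyRegular_normTwist` with the quantifier
`∀ m` specialised to `m = 0`, derived from `FakhruddinPilloni2021_odd_of_weaklyRegular` and
`FakhruddinPilloni2021_galoisRep_of_weaklyRegular_odd`. [cite: FakhruddinPilloni2021, Thm. 9.7 and Thm. 9.10] -/
theorem FakhruddinPilloni2021_galoisRep_of_weaklyRegular_normTwist_of_eq_zero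
    (h97 : FakhruddinPilloni2021_odd_of_weaklyRegular)
    (h910 : FakhruddinPilloni2021_galoisRep_of_weaklyRegular_odd)
    (n : ℕ) (K : Type) [Field K] [NumberField K] [IsCMField K]
    (hcpt : isCompact_glFiniteIntegralLevel n K) (π : CuspidalAutomorphicRepData n K hcpt)
    (T : InfinityType K n) (hT : π.1.HasInfinityType T) (hC : T.IsCAlgebraic)
    (hW : T.IsWeaklyRegular) (hE : ¬ T.IsEvenlyPaired)
    (χ : Literature.NumberTheory.GaloisRepresentations.HeckeCharacter K) (m : ℤ) (hm : m = 0)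
    (hχ : ∀ x : Literature.NumberTheory.GaloisRepresentations.ideleGroup K,
      ((χ x : ℂˣ) : ℂ) = (Literature.NumberTheory.GaloisRepresentations.ideleNorm x : ℂ) ^ (m : ℂ))
    (hsd : π.1.IsEssConjSelfDual χ) (ℓ : ℕ) [Fact ℓ.Prime] (ι : PadicAlgCl ℓ ≃+* ℂ) :
    ∃ r : GaloisRepresentations.FramedGaloisRep K (PadicAlgCl ℓ) n,
      ∀ (v : HeightOneSpectrum (𝓞 K)) (α : Multiset ℂ), π.1.HasSatakeParamAt v α →
        ((ℓ : ℕ) : 𝓞 K) ∉ v.asIdeal →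
          r.IsUnramifiedAt v ∧ r.HasFrobCharpolyAt v (arithFrobPolyOfSatake ι v.residueCard n α) := by
  subst hm
  exact FakhruddinPilloni2021_galoisRep_of_weaklyRegular_normTwist_zero h97 h910 π hT hC hW hE
    hχ hsd ℓ ι

/-! ### Twist-invariance of weak regularity and of the evenly-paired configuration

Both notions only read the multisets of `a`-exponents, which a twist `T.twist s`
(`(a, b) ↦ (a + s, b + s)`, Buzzard–Gee's `π ⊗ |det|^s` on infinity types) translates by `s`
(`InfinityType.map_a_twist` of `AlgebraicityTwist`, imported for this purpose);
used to pass between the `C`- and `L`-normalisations (route `Langlands/DegenerateLimits` is stated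
for `L`-algebraic `π`) and for the reduction of even `m` to `m = 0` by `π ⊗ ‖det‖^{-m/2}`. -/

namespace InfinityType

variable {K : Type*} [Field K] {n : ℕ}

/-- Twisting preserves weak regularity (translate both halves `μ`, `ν`).
[cite: FakhruddinPilloni2021, §9.1 (Weakly regular)] -/
theorem IsWeaklyRegular.twist {T : InfinityType K n} (h : T.IsWeaklyRegular) (s : ℂ) :
    (T.twist s).IsWeaklyRegular := by
  intro σ
  obtain ⟨μ, ν, hμν, hcard, hμ, hν⟩ := h σ
  refine ⟨μ.map (· + s), ν.map (· + s), ?_, ?_, ?_, ?_⟩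
  · rw [map_a_twist, hμν, Multiset.map_add]
  · rw [Multiset.card_map, hcard]
  · exact hμ.map (add_left_injective s)
  · exact hν.map (add_left_injective s)

/-- Twisting preserves the evenly-paired configuration (translate `μ`).
[cite: FakhruddinPilloni2021, Thm. 9.7] -/
theorem IsEvenlyPaired.twist {T : InfinityType K n} (h : T.IsEvenlyPaired) (s : ℂ) :
    (T.twist s).IsEvenlyPaired := by
  refine ⟨h.1, fun σ => ?_⟩
  obtain ⟨μ, hμ⟩ := h.2 σ
  exact ⟨μ.map (· + s), by rw [map_a_twist, hμ, Multiset.map_add]⟩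

/-- Weak regularity is twist-invariant (untwist by `-s`: `twist_twist`, `twist_zero`).
[cite: FakhruddinPilloni2021, §9.1 (Weakly regular)] -/
theorem isWeaklyRegular_twist_iff (T : InfinityType K n) (s : ℂ) :
    (T.twist s).IsWeaklyRegular ↔ T.IsWeaklyRegular := by
  refine ⟨fun h => ?_, fun h => h.twist s⟩
  have h' := h.twist (-s)
  rwa [twist_twist, add_neg_cancel, twist_zero] at h'

/-- The evenly-paired configuration is twist-invariant. [cite: FakhruddinPilloni2021, Thm. 9.7] -/
theorem isEvenlyPaired_twist_iff (T : InfinityType K n) (s : ℂ) :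
    (T.twist s).IsEvenlyPaired ↔ T.IsEvenlyPaired := by
  refine ⟨fun h => ?_, fun h => h.twist s⟩
  have h' := h.twist (-s)
  rwa [twist_twist, add_neg_cancel, twist_zero] at h'

/-- An **integral** twist preserves `C`-algebraicity (`a, b ∈ ℤ + (n-1)/2` are translated by an
integer). [cite: BuzzardGee2014, §3.1] -/
theorem IsCAlgebraic.twist_intCast {T : InfinityType K n} (h : T.IsCAlgebraic) (k : ℤ) :
    (T.twist (k : ℂ)).IsCAlgebraic := by
  intro σ p hp
  rw [InfinityType.twist_apply, Multiset.mem_map] at hp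
  obtain ⟨p₀, hp₀, rfl⟩ := hp
  obtain ⟨a, b, ha, hb⟩ := h σ p₀ hp₀
  refine ⟨a + k, b + k, ?_, ?_⟩
  · change p₀.a + k = _
    rw [ha]; push_cast; ring
  · change p₀.b + k = _
    rw [hb]; push_cast; ring

end InfinityType

end Literature.NumberTheory.Automorphic

/-! ## Relocated from `Summits/Langlands/Langlands/Theorems/QuadraticWindowHostInducedRepGaloisOverKBridge.lean` (gate, accept-time relocation of cited facts) — ArthurClozelAMS120, Bump1997, CogdellAnalyticTheory2004, JacquetShalikaAJM1981II, PiatetskiShapiroCorvallis1979 -/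

namespace Literature.NumberTheory.Automorphic

open Literature.NumberTheory.Automorphic Literature.NumberTheory.GaloisRepresentations
open IsDedekindDomain NumberField Filter Polynomial

/-- **Strong multiplicity one for the pair `(Π^c, Π^∨)` of a cuspidal `Π` over a CM field: conjugate
self-duality almost everywhere on Satake parameters implies conjugate self-duality in the pairing
form.**  Printed sources.  Jacquet–Shalika 1981 (II), Thm. 4.4 (with Piatetski-Shapiro 1979,
multiplicity one): two irreducible cuspidal automorphic representations `π₁`, `π₂` of `GL_N(𝔸_K)` with
`π_{1,w} ≅ π_{2,w}` for almost all finite places `w` coincide (same space of cusp forms), in particular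
`π₁ ≅ π₂`.  Applied to `π₁ = Π^c` (`Π^c(g) = Π(c g)`, again cuspidal, with unramified components
`Sat(Π^c, w) = Sat(Π, c w)`: Arthur–Clozel, Ch. 3 §1 and p. 172; tree `AutomorphicGaloisConj`) and to
`π₂ = Π^∨` (the contragredient, cuspidal, realised on `g ↦ φ(ᵗg⁻¹)`, with `Sat(Π^∨, w) = Sat(Π, w)⁻¹`:
Gelfand–Kazhdan, Cogdell 2004 §2 Thm. 2.1, Getz–Hahn Prop. 7.6.2; tree `CuspidalContragredient`):
**if `Sat(Π, c w) = Sat(Π, w)⁻¹` for almost all `w`, then `Π^c ≅ Π^∨`.**  (The central character need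
not be unitary: writing `Π = Π₀ ⊗ |det|^s` with `Π₀` unitary, the hypothesis read on central characters
forces `Re s = 0` for `N ≥ 1`, so `Π` is unitary and Jacquet–Shalika applies.)
Rendering: the hypothesis is the accepted `AutomorphicRepData.IsConjSelfDualAE Π c` of `AsaiSign`
(`c = NumberField.IsCMField.complexConj K`; its docstring: "for cuspidal `Π` equivalent to `Π^c ≅ Π^∨`
by strong multiplicity one"); the conclusion is the accepted PAIRING form
`AutomorphicRepData.IsEssConjSelfDual Π 1` of `Π^c ≅ Π^∨` (`EssConjSelfDual`: a bilinear pairing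
`B` on `Π`, non-degenerate in each variable, with `B(Π(c g) x, Π(g) y) = B(x, y)` on `GL_N(𝔸_K^∞)`,
`K_∞` and `𝔤` — i.e. a non-zero invariant pairing `Π^c × Π → ℂ`, an isomorphism `Π^c ≅ Π^∨` for the
admissible `Π`, Bump §4.2; from `⟨·,·⟩ : Π^∨ × Π → ℂ` and `Π^c ≅ Π^∨` take `B(x, y) = ⟨x ∘ c, y⟩`),
which is the hypothesis "conjugate self dual" of the vendored Fakhruddin–Pilloni facts
(`FakhruddinPilloni2021_galoisRep_of_weaklyRegular_odd`, `…_odd_of_weaklyRegular`).  `0 < N`.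
Named fact (D-0014), not proved here: the tree has strong multiplicity one for Borel–Jacquet data in the
`W`-level form (`CuspidalAutomorphicRepData.W_eq_of_isNearlyEquivalent_of_clean` of
`StrongMultiplicityOneRepData`, from the named facts `strong_multiplicity_one_gl_sphericalLevel` and
`hasSatakeParamAt_iff_L2`), but has neither `Π^∨` as a Borel–Jacquet datum (only the Satake-level named
fact `CuspidalAutomorphicRepData.exists_contragredient_satake`) nor the invariant pairings of `Π^c` and
`Π^∨` with `Π`.
-- TODO(general form): nearly equivalent cuspidal Borel–Jacquet data are isomorphic
-- `(𝔤, K_∞) × GL_N(𝔸_K^∞)`-modules (Jacquet–Shalika 1981 (II), Thm. 4.4, all of it).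
[cite: JacquetShalikaAJM1981II, Thm. 4.4] [cite: PiatetskiShapiroCorvallis1979]
[cite: ArthurClozelAMS120, Ch. 3 §1 and p. 172] [cite: CogdellAnalyticTheory2004, §2 Thm. 2.1]
[cite: Bump1997, §4.2] [file NumberTheory/Automorphic/WeaklyRegularGaloisRep] -/
def JacquetShalika1981_isEssConjSelfDual_of_isConjSelfDualAE : Prop :=
  ∀ (N : ℕ) (K : Type) [Field K] [NumberField K] [IsCMField K]
    (hcpt : isCompact_glFiniteIntegralLevel N K) (P : CuspidalAutomorphicRepData N K hcpt),
    0 < N → P.1.IsConjSelfDualAE (NumberField.IsCMField.complexConj K) → P.1.IsEssConjSelfDual 1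

end Literature.NumberTheory.Automorphic

/-! ### Appended 2026-08-17 (literature-prover, provefact seat `HarrisLanTaylorThorne2016_corollary13_cuspidalUnitary`):
the REGULAR slice of `FakhruddinPilloni2021_galoisRep_of_weaklyRegular_normTwist`

The constituents `Π_i` produced by cohomological base change (Harris–Lan–Taylor–Thorne 2016,
Prop. 1.2) are REGULAR ALGEBRAIC and norm-polarized; the `normTwist` fact is stated for the wider
class "C-algebraic, weakly regular, not evenly paired".  The passage regular algebraic ⇒ those three
hypotheses is recorded here as proved theorems (companions of `IsRegular.isWeaklyRegular` and
`not_isEvenlyPaired_of_odd_count` above): a regular type of positive rank has an exponent of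
multiplicity one, hence is not evenly paired; and `IsRegularAlgebraic` unfolds to an infinity type
that is C-algebraic and regular.  No new fact; the named fact enters as a hypothesis.
-/

namespace Literature.NumberTheory.Automorphic

open scoped NumberField
open NumberField IsDedekindDomain
open Literature.NumberTheory.GaloisRepresentations (HeckeCharacter ideleGroup ideleNorm FramedGaloisRep)

/-- A **regular** infinity type with `n ≥ 1` weights at every embedding is **not evenly paired**:
any exponent occurs exactly once (`Multiset.count_eq_one_of_mem`), an odd multiplicity, which the
doubled configuration `μ + μ` of Fakhruddin–Pilloni's exceptional case excludes
(`not_isEvenlyPaired_of_odd_count`). [cite: FakhruddinPilloni2021, Thm. 9.1 and Thm. 9.7 (the exceptional configuration)] -/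
theorem InfinityType.IsRegular.not_isEvenlyPaired {K : Type*} [Field K] [NumberField K] {n : ℕ}
    {T : InfinityType K n} (hT : T.IsRegular) (hcard : ∀ σ : K →+* ℂ, Multiset.card (T σ) = n)
    (hn : 0 < n) : ¬ T.IsEvenlyPaired := by
  classical
  obtain ⟨σ⟩ : Nonempty (K →+* ℂ) := inferInstance
  have hne : (T σ).map ArchWeight.a ≠ 0 := by
    intro h0
    have h := congrArg Multiset.card h0
    rw [Multiset.card_map, hcard σ, Multiset.card_zero] at h
    omega
  obtain ⟨a, ha⟩ := Multiset.exists_mem_of_ne_zero hne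
  refine InfinityType.not_isEvenlyPaired_of_odd_count (σ := σ) (a := a) ?_
  rw [Multiset.count_eq_one_of_mem (hT σ) ha]
  exact odd_one

/-- **The regular slice of Fakhruddin–Pilloni, Thm. 9.10 with Thm. 9.1 (`χ = ‖·‖_𝔸^m`)** (proved
composite; the named fact `FakhruddinPilloni2021_galoisRep_of_weaklyRegular_normTwist` enters as a
hypothesis): for `K` CM, `0 < n`, and `π` a REGULAR ALGEBRAIC cuspidal automorphic representation of
`GL_n(𝔸_K)` with `π^c ≅ π^∨ ⊗ (χ ∘ det)`, `χ = ‖·‖_𝔸^m` (`IsEssConjSelfDual π χ`), for every prime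
`ℓ` and `ι : ℚ̄_ℓ ≃ ℂ` there is a continuous `r : Γ_K → GL_n(ℚ̄_ℓ)` which at every finite `v ∤ ℓ`
where `π` has Satake parameter `α` is unramified with arithmetic-Frobenius characteristic polynomial
`arithFrobPolyOfSatake ι q_v n α`.  Reduction: `IsRegularAlgebraic` gives an infinity type `T`
with `HasInfinityType T` (in particular `n` weights at each embedding), C-algebraic and regular;
regular ⇒ weakly regular (`IsRegular.isWeaklyRegular`) and, as `0 < n`, not evenly paired
(`IsRegular.not_isEvenlyPaired`).  (For such `π` the printed source of the conclusion is the regular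
polarized case, Barnet-Lamb–Gee–Geraghty–Taylor 2014 Thm. 2.1.1, vendored with semisimplicity and
`E_λ`-models as `BLGGT2014_polarized_compatibleSystem_rationalModels`; this slice carries no
semisimplicity clause.) [cite: FakhruddinPilloni2021, Thm. 9.10 and Thm. 9.1] -/
theorem FakhruddinPilloni2021_galoisRep_of_regularAlgebraic_normTwist
    (h : FakhruddinPilloni2021_galoisRep_of_weaklyRegular_normTwist)
    {n : ℕ} (hn : 0 < n) {K : Type} [Field K] [NumberField K] [IsCMField K]
    {hcpt : isCompact_glFiniteIntegralLevel n K} (π : CuspidalAutomorphicRepData n K hcpt)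
    (hra : π.1.IsRegularAlgebraic) {χ : HeckeCharacter K} {m : ℤ}
    (hχ : ∀ x : ideleGroup K, ((χ x : ℂˣ) : ℂ) = (ideleNorm x : ℂ) ^ (m : ℂ))
    (hsd : π.1.IsEssConjSelfDual χ) (ℓ : ℕ) [Fact ℓ.Prime] (ι : PadicAlgCl ℓ ≃+* ℂ) :
    ∃ r : FramedGaloisRep K (PadicAlgCl ℓ) n,
      ∀ (v : HeightOneSpectrum (𝓞 K)) (α : Multiset ℂ), π.1.HasSatakeParamAt v α →
        ((ℓ : ℕ) : 𝓞 K) ∉ v.asIdeal →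
          r.IsUnramifiedAt v ∧ r.HasFrobCharpolyAt v (arithFrobPolyOfSatake ι v.residueCard n α) := by
  obtain ⟨T, hT, hC, hR⟩ := hra
  exact h n K hcpt π T hT hC (hR.isWeaklyRegular hT.1.1) (hR.not_isEvenlyPaired hT.1.1 hn) χ m hχ
    hsd ℓ ι

end Literature.NumberTheory.Automorphic
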